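import Summits.QuantumFields.BalabanUV.T4Continuum.Support.SmallFieldDomainsCubes

/-!
# T⁴ programme, SUBSTRATE — `Support/SmallFieldDomainsCover`, part 3/3 of `Support/SmallFieldDomains`: the COVERING LEMMA for the
# [Balaban1985Variational] pp. 278–279 class of cubes on `ℤ^d`, and the covering as DATA (a level map constant on
# `L`-blocks)

CITATION HEADER (lean-in-tree rule 2026-08-18).  Sources (papers UNDER ADJUDICATION by the audit cell `pub-balaban`;
nothing of them is asserted — this module DEFINES concrete `ℤ^d` readings of three printed geometric notions and PROVES
elementary facts about the definitions):
* [Balaban1985RegularSpaces] T. Bałaban, *Spaces of regular gauge field configurations on a lattice and gauge fixing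
  conditions*, Commun. Math. Phys. **99** (1985) 75–102 (cell paper B8; journal page = PDF page + 74), p. 77 (1.3)–(1.5):
  *"Ω₀ ⊃ Ω₁ ⊃ Ω₂ ⊃ … ⊃ Ω_k, Ω_j ⊂ T_η (1.3) … Ω_j = B^j(Ω_j^{(j)}), Ω_j is a sum of cubes of a size M₁L^jη,
  (L^jη)^{-1} dist(Ω_j^c, Ω_{j+1}) > RM₁. (1.4)"* — typed in `…B8ConstraintBonds` as `DomainSeq` with the WEAK radius
  `L^{j+1}`; here the printed radii are kept (`BigDomainSeq`, §1) and the bridge to `DomainSeq` is proved.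
* [Balaban1985BackgroundPropagators] T. Bałaban, *Propagators for lattice gauge theories in a background field*, Commun.
  Math. Phys. **99** (1985) 389–434 (cell paper B9; journal page = PDF page + 388), p. 396 [PDF 8], read on the held text
  `paper:balaban1985-cmp99-background-propagators` p. 8: *"At first let us introduce a class of cubes. For each cube □ of
  this class there exists a unique index j, 0 ≤ j ≤ k, such that □ ⊂ B^j(Λ_j) ∪ B^{j+1}(Λ_{j+1}), □ ∩ B^j(Λ_j) ≠ ∅, and
  □ is a union of several big blocks of the lattice T_{L−j} [sic: the lattice of spacing L^jη], which implies that
  its size in the lattice T_η is O(1)ML^jη. Here O(1) will mean a number ≧ 10."* (glyph «≧» re-read on the render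
  `…1985-cmp99-background-propagators-p008-x2.png` by XREAD F-ne9leaf09g10-1 — v1 of this header had «≤ 10» from the OCR layer;
  corroboration p. 409: *"the number O(1) in the condition (3.35) can be taken as equal to 12"*; cell DIVERGENCE.md D-ne9leaf09g10-1)
  (§3: `IsClassCubeB9`, `ten_le : 10 ≤ nblk`; the asserted UNIQUENESS of the index is PROVED, `IsClassCubeB9.index_unique`).
* [Balaban1985Variational] T. Bałaban, *The variational problem and background fields in renormalization group method
  for lattice gauge theories*, Commun. Math. Phys. **102** (1985) 277–309 (cell paper B11; journal page = PDF page +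
  276), pp. 278–279 [PDF 2–3], read on the held text `paper:balaban1985-cmp102-variational-background` pp. 2–3: *"To
  formulate them we have to introduce a class of cubes. This class was described in Sect. F [6]. Each cube □ of this
  class is contained in B^j(Λ_j) ∪ B^{j+1}(Λ_{j+1}) = Ω_j∖Ω_{j+2} for some j between 0 and k, and is a union of big
  blocks of the L^{-j}-lattice. More exactly we assume that □ has a size 2ML^jη, where M is a multiple of R₁M₁, and
  that the cube □̃ of the size (2M + 4R₁M₁)L^jη and with the same center as □, is contained in B^j(Λ_j) ∪
  B^{j+1}(Λ_{j+1}), but not in B^{j+1}(Λ_{j+1}). We consider all cubes □ satisfying the above conditions."* (§4: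
  `IsClassCubeB11`).


CONTENT (same namespace as parts 1–2; audit cell `pub-balaban`, SUBSTRATE cell seat p4; `substrate/SUBSTRATE-MAP.md` §p4):
 * §5 **`exists_classCubeB11_deep`**: if `Ω₀ = T` (`Set.univ`) and `12·(R₁+1)·L ≤ R`, EVERY point `x` lies `M₁L^j`-deep
   (sup-metric) in a [B11] class cube of index `j ∈ {ι(x), ι(x)−1}` (`ι` = `ptIndex`) centred at the corner of `x`'s
   level-`j` big block, with size parameter `M ∈ {2R₁M₁, 5L·R₁M₁}`; as DATA — `InteriorTest`, `coverLevel`,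
   `coverSize`, **`cover_classCubeB11`** — the level and size maps are CONSTANT ON `L`-BLOCKS
   (**`coverLevel_eq_of_cubeIdx_eq`**), the form in which a window-level map with one level per coarse site (row NE7's
   `lvlA`/`lvlB` of `Support/TermwiseLocalThm1Ledger.lean`) consumes the covering.
HONEST FRAMING (T4-DAG p. 1).  Region BOOKKEEPING on `ℤ^d` (universal cover of the torus), fine-lattice units `η = 1`; no
configuration, no estimate, no torus identification; the printed sentences quoted above are DOCUMENTATION of what the three
hypothesis SHAPES read (bracketed keys are CONTEXT, not cite tags) — nothing printed is asserted, no `def … : Prop` fact is minted;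
PLACEMENT: the cell's own bookkeeping mathematics ⇒ `Summits/…/T4Continuum/Support/` (gate `lint.literature-cited-only`),
importing the `Literature.…Balaban1983to89.*` geometry modules (allowed direction).  NOT NE2/NE3/NE7 content; spine 0/9
unchanged; NOT infinite volume, NOT a mass gap, NOT Clay.  HONEST DEPENDENCY: continuum YM on T⁴ ⇐ BetaPertH ∧ nine spine
estimates (0/9 proved); BetaPertH ⇐ (D1) ∧ (D4) ∧ CAP+tail; G-an2-4 gates asym, D1 and NE2/3/4.  No `sorry`.
-/

namespace Summit.QuantumFields.BalabanUV.T4Continuum.SmallFieldDomains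

open Literature.MathematicalPhysics.QuantumFieldTheory.Balaban1983to89.B14DomainGeom
open Literature.MathematicalPhysics.QuantumFieldTheory.Balaban1983to89.B8ConstraintBonds (IsLevel Lam DomainSeq)
open Literature.MathematicalPhysics.QuantumLattice (blockMap blockBase)

variable {d : ℕ}

section Cover

variable {L M₁ R R₁ k : ℕ} {Ω : ℕ → Set (Pt d)}

/-! ## §5 The covering lemma and the covering as data -/

/-- **THE COVERING LEMMA** ([B11] class; `Ω₀ = T`, `12(R₁+1)L ≤ R`): EVERY point `x` lies `M₁L^j`-deep (sup-metric)
in a [B11] class cube `(j, c, M)` whose index is the point index `ι(x)` or `ι(x) − 1`, whose centre is the corner of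
`x`'s level-`j` big block, and whose size parameter is `2R₁M₁` or `5L·R₁M₁` (so `M ≤ 5L·R₁M₁`).  This is the geometric
content of the per-level coverings `hcoverA`/`hcoverB`/`hcoverBf` displayed in `Support/TermwiseLocalThm1Ledger.lean`
(row NE7), on `ℤ^d`. [folklore] -/
theorem exists_classCubeB11_deep (hΩ : BigDomainSeq L M₁ R k Ω) (h0 : Ω 0 = Set.univ) (hL : 1 ≤ L) (hM₁ : 1 ≤ M₁)
    (hR₁ : 1 ≤ R₁) (hR : 12 * (R₁ + 1) * L ≤ R) (x : Pt d) :
    ∃ j M, IsClassCubeB11 L M₁ R₁ k Ω j (corner (M₁ * L ^ j) x) M ∧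
      (j = ptIndex k Ω x ∨ j + 1 = ptIndex k Ω x) ∧ (M = 2 * (R₁ * M₁) ∨ M = 5 * L * (R₁ * M₁)) ∧
      ∀ y, Within ((M₁ * L ^ j : ℕ) : ℤ) x y → y ∈ ccube (corner (M₁ * L ^ j) x) ((M * L ^ j : ℕ) : ℤ) := by
  have hx0 : x ∈ Ω 0 := by rw [h0]; exact Set.mem_univ x
  have hx : x ∈ layer Ω (ptIndex k Ω x) := mem_layer_ptIndex hΩ hx0
  by_cases hA : ccube (corner (M₁ * L ^ ptIndex k Ω x) x) (((4 * (R₁ * M₁)) * L ^ ptIndex k Ω x : ℕ) : ℤ) ⊆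
      Ω (ptIndex k Ω x)
  · obtain ⟨hcube, hdeep⟩ := interior_classCubeB11 hΩ hL hM₁ hR₁ hR hx hA
    exact ⟨_, _, hcube, Or.inl rfl, Or.inl rfl, hdeep⟩
  · obtain ⟨z, hz, hzΩ⟩ := Set.not_subset.mp hA
    -- the collar regime only occurs at positive index (`Ω₀ = T`)
    obtain ⟨j, hj⟩ : ∃ j, ptIndex k Ω x = j + 1 := by
      rcases Nat.eq_zero_or_pos (ptIndex k Ω x) with h | h
      · exact absurd (by rw [h, h0]; exact Set.mem_univ z) hzΩ
      · exact ⟨ptIndex k Ω x - 1, by omega⟩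
    rw [hj] at hx hz hzΩ
    obtain ⟨hcube, hdeep⟩ := collar_classCubeB11 hΩ hL hM₁ hR₁ hR hx hz hzΩ
    exact ⟨j, _, hcube, Or.inr hj.symm, Or.inr rfl, hdeep⟩

/-! ### The covering as DATA: a level map constant on `L`-blocks -/

/-- The INTERIOR-REGIME TEST at `x`: the enlargement (half-side `4R₁M₁L^ι`) of the natural cube of index `ι = ι(x)` about
the corner of `x`'s big block fits in `Ω_ι`. [folklore] -/
def InteriorTest (L M₁ R₁ k : ℕ) (Ω : ℕ → Set (Pt d)) (x : Pt d) : Prop :=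
  ccube (corner (M₁ * L ^ ptIndex k Ω x) x) (((4 * (R₁ * M₁)) * L ^ ptIndex k Ω x : ℕ) : ℤ) ⊆ Ω (ptIndex k Ω x)

open Classical in
/-- The LEVEL of the covering cube at `x`: `ι(x)` in the interior regime, `ι(x) − 1` in the collar regime. [folklore] -/
noncomputable def coverLevel (L M₁ R₁ k : ℕ) (Ω : ℕ → Set (Pt d)) (x : Pt d) : ℕ :=
  if InteriorTest L M₁ R₁ k Ω x then ptIndex k Ω x else ptIndex k Ω x - 1

open Classical in
/-- The SIZE PARAMETER of the covering cube at `x`: `2R₁M₁` (interior) or `5L·R₁M₁` (collar). [folklore] -/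
noncomputable def coverSize (L M₁ R₁ k : ℕ) (Ω : ℕ → Set (Pt d)) (x : Pt d) : ℕ :=
  if InteriorTest L M₁ R₁ k Ω x then 2 * (R₁ * M₁) else 5 * L * (R₁ * M₁)

/-- The covering level is `ι(x)` or `ι(x) − 1` (hence within one of the point index). [folklore] -/
theorem coverLevel_eq_or (L M₁ R₁ k : ℕ) (Ω : ℕ → Set (Pt d)) (x : Pt d) :
    coverLevel L M₁ R₁ k Ω x = ptIndex k Ω x ∨ coverLevel L M₁ R₁ k Ω x = ptIndex k Ω x - 1 := by
  unfold coverLevel; split_ifs <;> simp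

/-- The covering level is at most `k`. [folklore] -/
theorem coverLevel_le (L M₁ R₁ k : ℕ) (Ω : ℕ → Set (Pt d)) (x : Pt d) : coverLevel L M₁ R₁ k Ω x ≤ k := by
  have := ptIndex_le k Ω x
  rcases coverLevel_eq_or L M₁ R₁ k Ω x with h | h <;> omega

/-- The size parameter is `2R₁M₁` or `5L·R₁M₁`. [folklore] -/
theorem coverSize_eq_or (L M₁ R₁ k : ℕ) (Ω : ℕ → Set (Pt d)) (x : Pt d) :
    coverSize L M₁ R₁ k Ω x = 2 * (R₁ * M₁) ∨ coverSize L M₁ R₁ k Ω x = 5 * L * (R₁ * M₁) := by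
  unfold coverSize; split_ifs <;> simp

/-- The size parameter is at most `5L·R₁M₁` (for `L ≥ 1`). [folklore] -/
theorem coverSize_le (hL : 1 ≤ L) (M₁ R₁ k : ℕ) (Ω : ℕ → Set (Pt d)) (x : Pt d) :
    coverSize L M₁ R₁ k Ω x ≤ 5 * L * (R₁ * M₁) := by
  rcases coverSize_eq_or L M₁ R₁ k Ω x with h | h
  · rw [h]; nlinarith
  · rw [h]

/-- **THE COVERING AS DATA**: with the level `coverLevel`, the centre = the corner of `x`'s big block at that level, and
the size parameter `coverSize`, every `x` is covered `M₁L^j`-deep by a [B11] class cube. [folklore] -/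
theorem cover_classCubeB11 (hΩ : BigDomainSeq L M₁ R k Ω) (h0 : Ω 0 = Set.univ) (hL : 1 ≤ L) (hM₁ : 1 ≤ M₁)
    (hR₁ : 1 ≤ R₁) (hR : 12 * (R₁ + 1) * L ≤ R) (x : Pt d) :
    IsClassCubeB11 L M₁ R₁ k Ω (coverLevel L M₁ R₁ k Ω x) (corner (M₁ * L ^ coverLevel L M₁ R₁ k Ω x) x)
        (coverSize L M₁ R₁ k Ω x) ∧
      ∀ y, Within ((M₁ * L ^ coverLevel L M₁ R₁ k Ω x : ℕ) : ℤ) x y →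
        y ∈ ccube (corner (M₁ * L ^ coverLevel L M₁ R₁ k Ω x) x)
          ((coverSize L M₁ R₁ k Ω x * L ^ coverLevel L M₁ R₁ k Ω x : ℕ) : ℤ) := by
  classical
  have hx0 : x ∈ Ω 0 := by rw [h0]; exact Set.mem_univ x
  have hx : x ∈ layer Ω (ptIndex k Ω x) := mem_layer_ptIndex hΩ hx0
  by_cases hA : InteriorTest L M₁ R₁ k Ω x
  · have hl : coverLevel L M₁ R₁ k Ω x = ptIndex k Ω x := by simp [coverLevel, hA]
    have hsz : coverSize L M₁ R₁ k Ω x = 2 * (R₁ * M₁) := by simp [coverSize, hA]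
    rw [hl, hsz]
    exact interior_classCubeB11 hΩ hL hM₁ hR₁ hR hx hA
  · have hl : coverLevel L M₁ R₁ k Ω x = ptIndex k Ω x - 1 := by simp [coverLevel, hA]
    have hsz : coverSize L M₁ R₁ k Ω x = 5 * L * (R₁ * M₁) := by simp [coverSize, hA]
    obtain ⟨z, hz, hzΩ⟩ := Set.not_subset.mp hA
    obtain ⟨j, hj⟩ : ∃ j, ptIndex k Ω x = j + 1 := by
      rcases Nat.eq_zero_or_pos (ptIndex k Ω x) with h | h
      · exact absurd (by rw [h, h0]; exact Set.mem_univ z) hzΩ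
      · exact ⟨ptIndex k Ω x - 1, by omega⟩
    rw [hj] at hx hz hzΩ hl
    rw [Nat.add_sub_cancel] at hl
    rw [hl, hsz]
    exact collar_classCubeB11 hΩ hL hM₁ hR₁ hR hx hz hzΩ

/-- **THE LEVEL AND SIZE MAPS ARE CONSTANT ON `L`-BLOCKS** (`Ω₀ = T`): the form in which a window-level map with one level
per coarse site (row NE7's `lvlA`/`lvlB`) consumes the covering. [folklore] -/
theorem coverLevel_eq_of_cubeIdx_eq (hΩ : BigDomainSeq L M₁ R k Ω) (h0 : Ω 0 = Set.univ) {x y : Pt d}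
    (hxy : cubeIdx L x = cubeIdx L y) :
    coverLevel L M₁ R₁ k Ω x = coverLevel L M₁ R₁ k Ω y ∧ coverSize L M₁ R₁ k Ω x = coverSize L M₁ R₁ k Ω y := by
  classical
  have hU : IsUnionOfCubes L (Ω 0) := by rw [h0]; exact isUnionOfCubes_univ L
  have hι : ptIndex k Ω x = ptIndex k Ω y := ptIndex_eq_of_cubeIdx_eq hΩ hU hxy
  have htest : InteriorTest L M₁ R₁ k Ω x ↔ InteriorTest L M₁ R₁ k Ω y := by
    unfold InteriorTest
    rw [hι]
    rcases Nat.eq_zero_or_pos (ptIndex k Ω y) with hz | hpos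
    · -- index `0`: both enlargements lie in `Ω₀ = T`
      rw [hz, h0]
      simp
    · -- positive index: the big blocks of `x` and `y` coincide (the `L`-blocks refine them), so the corners do
      have hc : corner (M₁ * L ^ ptIndex k Ω y) x = corner (M₁ * L ^ ptIndex k Ω y) y := by
        apply corner_eq_of_cubeIdx_eq
        have e : M₁ * L ^ ptIndex k Ω y = L * (M₁ * L ^ (ptIndex k Ω y - 1)) := by
          obtain ⟨i, hi⟩ := Nat.exists_eq_add_of_le hpos
          rw [hi, Nat.add_sub_cancel_left, pow_add, pow_one]; ring
        rw [e]
        exact cubeIdx_mul_eq_of_eq L _ hxy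
      rw [hc]
  simp only [coverLevel, coverSize, hι, htest, and_self]

end Cover

end Summit.QuantumFields.BalabanUV.T4Continuum.SmallFieldDomains
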